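import Mathlib
import HarnessLib
import Summits.ValiantsHypothesis.ValiantsHypothesis.Theses.MonotoneRestoration
import Literature.Computability.AlgebraicComplexity.ArithCircuit
import Literature.Computability.AlgebraicComplexity.ArithCircuitProofs
import Literature.Computability.AlgebraicComplexity.MonotoneStructure
import Literature.Computability.AlgebraicComplexity.PermanentIrreducible
import Literature.ModelTheory.FiniteModelTheory.CkEquiv
import Summits.ValiantsHypothesis.ValiantsHypothesis.Theorems.MonotoneRestorationMonotoneRestorationQPCosetCount
import Summits.ValiantsHypothesis.ValiantsHypothesis.Theorems.MonotoneRestorationMonotoneRestorationQPSymmetricLB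
import Summits.ValiantsHypothesis.ValiantsHypothesis.Theorems.MonotoneRestorationMonotoneRestorationQPSupportSymmetrisation
import Summits.ValiantsHypothesis.ValiantsHypothesis.Theorems.MonotoneRestorationMonotoneRestorationQPSparseRegime
import Summits.ValiantsHypothesis.ValiantsHypothesis.Theorems.MonotoneRestorationMonotoneRestorationQPBeta
import Literature.Computability.AlgebraicComplexity.SymmetricArithCircuit
import Literature.Computability.AlgebraicComplexity.DawarWilsenach2025Proofs
import Literature.GroupTheory.PermutationGroups.SmallIndexSubgroups
import Summits.ValiantsHypothesis.ValiantsHypothesis.Theorems.MonotoneRestorationQP.Negative.LoadBearing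
import Summits.ValiantsHypothesis.ValiantsHypothesis.Theorems.MonotoneRestorationMonotoneRestorationQPPermSupportCount

/-! TTRL-lite variant V18995 of stmt-ValiantsHypothesis-15886 -/

namespace Summit.ValiantsHypothesis.ValiantsHypothesis.Theorems

open Summit.ValiantsHypothesis.ValiantsHypothesis.Theses.MonotoneRestoration
open Literature.Computability.AlgebraicComplexity

/-- Orbit–stabiliser count for an arbitrary group action: if the whole orbit of `q` lies in a
finite set `T`, then the index of the stabiliser of `q` (which equals the size of the orbit) is at
most `T.card`. This is the quantitative half of the orbit dichotomy used by
`stub_altFixing_orbit_dichotomy`; no simplicity of the acting group is needed. -/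
theorem stub_altFixing_orbit_dichotomy_var18995 :
    ∀ (G : Type) [Group G] (γ : Type) [MulAction G γ] (q : γ) (T : Finset γ),
      (∀ g : G, g • q ∈ T) → (MulAction.stabilizer G q).index ≤ T.card := by
  intro G _ γ _ q T h
  have horb : MulAction.orbit G q ⊆ (↑T : Set γ) := by
    rintro _ ⟨g, rfl⟩
    exact h g
  calc (MulAction.stabilizer G q).index = Nat.card (MulAction.orbit G q) := by
        rw [Subgroup.index, Nat.card_congr (MulAction.orbitEquivQuotientStabilizer G q).symm]
    _ ≤ Nat.card (↑T : Set γ) := Nat.card_mono T.finite_toSet horb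
    _ = T.card := by simp

end Summit.ValiantsHypothesis.ValiantsHypothesis.Theorems
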